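import Literature.MathematicalPhysics.QuantumLattice.DuhamelTwoPoint

/-!
# Route BalabanIR — crux `BirGroundStateAverageLRO` (item `stmt-HubbardSuperconductivity-2079`), line `Sketch` (softmin-pair-penalty): Peierls–Jensen in a sector

Helper lemmas (finite-dimensional, folklore) for the softmin transfer of line `Sketch`
(idea card `Cruxes/BirGroundStateAverageLRO/Ideas/softmin-pair-penalty.md`): for Hermitian `H`, `B`,
`β > 0`, an idempotent Hermitian `P` commuting with `H` and `B` (a symmetry sector), and a unit
vector `ψ` with `P ψ = ψ`, `H ψ = e ψ`,

  `-(1/β) · log Re tr (P e^{-β(H - e·1 + B)}) ≤ Re ⟨ψ, B ψ⟩`      (`softmin_le_expect`)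

— Peierls' inequality for the vector state (`Re tr (P e^{-βK}) ≥ exp(-β Re⟨ψ, K ψ⟩)`,
`sectorZ_ge_exp_quadForm`, from Jensen `convexOn_exp` in an eigenbasis of `K` and
`Re⟨ψ, N ψ⟩ ≤ Re tr N` for the PSD compression `N = P e^{-βK} P`) together with
`⟨ψ, (H - e + B) ψ⟩ = ⟨ψ, B ψ⟩`. This is the first inequality of the lever (★) of the card; the proofs
are those of `Cruxes/BirGroundStateAverageLRO/SketchIdeator2.lean` §0 (crux-ideate, ideator 2), moved
under `Theorems` so that closing files can import them.

Sources: R. Peierls, Phys. Rev. 54 (1938) 918 (Peierls' inequality); B. Simon, *The Statistical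
Mechanics of Lattice Gases* I (1993), Thm. I.8.5; H. Tasaki, *Physics and Mathematics of Quantum
Many-Body Systems* (2020), App. A. Folklore; no definition is introduced.
-/

noncomputable section

namespace Summit.HubbardSuperconductivity.HubbardSuperconductivity.Theorems.BirGroundStateAverageLRO.Softmin

open Matrix Finset Literature.MathematicalPhysics.QuantumLattice
open scoped ComplexOrder

variable {n : Type*} [Fintype n] [DecidableEq n]

-- adapted from Cruxes/BirGroundStateAverageLRO/SketchIdeator2.lean §0 (planner-cruxidea-stmt-HubbardSuperconductivity-2079-2-0)

/-- `Re ⟨ψ, U diag(d) U⋆ ψ⟩ = Σᵢ dᵢ ‖(U⋆ψ)ᵢ‖²`. [folklore] -/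
theorem re_quadForm_conj_diagonal (U : Matrix n n ℂ) (d : n → ℝ) (ψ : n → ℂ) :
    (star ψ ⬝ᵥ ((U * diagonal (fun i => (d i : ℂ)) * star U) *ᵥ ψ)).re =
      ∑ i, d i * ‖(star U *ᵥ ψ) i‖ ^ 2 := by
  set φ : n → ℂ := star U *ᵥ ψ with hφ
  have h1 : (U * diagonal (fun i => (d i : ℂ)) * star U) *ᵥ ψ =
      U *ᵥ (diagonal (fun i => (d i : ℂ)) *ᵥ φ) := by
    rw [hφ, ← mulVec_mulVec, ← mulVec_mulVec]
  have h2 : star ψ ⬝ᵥ (U *ᵥ (diagonal (fun i => (d i : ℂ)) *ᵥ φ)) =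
      star φ ⬝ᵥ (diagonal (fun i => (d i : ℂ)) *ᵥ φ) := by
    rw [dotProduct_mulVec, hφ, star_mulVec, star_eq_conjTranspose, conjTranspose_conjTranspose]
  rw [h1, h2]
  simp only [dotProduct, mulVec_diagonal, Pi.star_apply, Complex.re_sum]
  refine sum_congr rfl fun i _ => ?_
  have : star (φ i) * ((d i : ℂ) * φ i) = ((d i * ‖φ i‖ ^ 2 : ℝ) : ℂ) := by
    rw [Complex.star_def, mul_left_comm, Complex.ofReal_mul, ← Complex.normSq_eq_norm_sq,
      ← Complex.mul_conj, mul_comm (φ i)]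
  rw [this, Complex.ofReal_re]

/-- `Σᵢ ‖(U⋆ψ)ᵢ‖² = Re ⟨ψ, ψ⟩` for unitary `U`. [folklore] -/
theorem sum_norm_sq_star_mulVec {U : Matrix n n ℂ} (hU : U ∈ unitary (Matrix n n ℂ)) (ψ : n → ℂ) :
    ∑ i, ‖(star U *ᵥ ψ) i‖ ^ 2 = (star ψ ⬝ᵥ ψ).re := by
  have h := re_quadForm_conj_diagonal U (fun _ => (1 : ℝ)) ψ
  have hd : diagonal (fun _ : n => ((1 : ℝ) : ℂ)) = 1 := by simp
  rw [hd, Matrix.mul_one, Unitary.mul_star_self_of_mem hU, one_mulVec] at h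
  rw [h]
  simp

/-- Spectral form of the quadratic form of a Hermitian matrix:
`Re ⟨ψ, A ψ⟩ = Σᵢ λᵢ ‖(U⋆ψ)ᵢ‖²` in the eigenbasis `U`. [folklore] -/
theorem re_quadForm_eq_sum_eigenvalues {A : Matrix n n ℂ} (hA : A.IsHermitian) (ψ : n → ℂ) :
    (star ψ ⬝ᵥ (A *ᵥ ψ)).re =
      ∑ i, hA.eigenvalues i * ‖(star (hA.eigenvectorUnitary : Matrix n n ℂ) *ᵥ ψ) i‖ ^ 2 := by
  conv_lhs => rw [hA.eq_conj_diagonal]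
  exact re_quadForm_conj_diagonal _ _ ψ

/-- Spectral form of `Re ⟨ψ, e^{-βA} ψ⟩`. [folklore] -/
theorem re_quadForm_gibbsWeight_eq_sum {A : Matrix n n ℂ} (hA : A.IsHermitian) (β : ℝ) (ψ : n → ℂ) :
    (star ψ ⬝ᵥ (gibbsWeight β A *ᵥ ψ)).re =
      ∑ i, Real.exp (-(β * hA.eigenvalues i)) *
        ‖(star (hA.eigenvectorUnitary : Matrix n n ℂ) *ᵥ ψ) i‖ ^ 2 := by
  rw [hA.gibbsWeight_eq β]
  exact re_quadForm_conj_diagonal _ _ ψ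

/-- **Jensen for the vector state**: `exp(-β Re⟨ψ, A ψ⟩) ≤ Re ⟨ψ, e^{-βA} ψ⟩` for a unit vector `ψ`
(convexity of `exp` against the spectral measure of `A` in `ψ`). [folklore] -/
theorem exp_neg_mul_quadForm_le {A : Matrix n n ℂ} (hA : A.IsHermitian) (β : ℝ) (ψ : n → ℂ)
    (hψ : star ψ ⬝ᵥ ψ = 1) :
    Real.exp (-(β * (star ψ ⬝ᵥ (A *ᵥ ψ)).re)) ≤ (star ψ ⬝ᵥ (gibbsWeight β A *ᵥ ψ)).re := by
  have hU : (hA.eigenvectorUnitary : Matrix n n ℂ) ∈ unitary (Matrix n n ℂ) :=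
    hA.eigenvectorUnitary.prop
  set w : n → ℝ := fun i => ‖(star (hA.eigenvectorUnitary : Matrix n n ℂ) *ᵥ ψ) i‖ ^ 2 with hw
  have hw1 : ∑ i, w i = 1 := by
    rw [hw, sum_norm_sq_star_mulVec hU ψ, hψ]; simp
  rw [re_quadForm_eq_sum_eigenvalues hA ψ, re_quadForm_gibbsWeight_eq_sum hA β ψ]
  have hJ := (convexOn_exp).map_sum_le (t := (univ : Finset n)) (w := w)
    (p := fun i => -(β * hA.eigenvalues i)) (fun i _ => by positivity) hw1
    (fun i _ => Set.mem_univ _)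
  simp only [smul_eq_mul] at hJ
  have hlhs : -(β * ∑ i, hA.eigenvalues i * w i) = ∑ i, w i * -(β * hA.eigenvalues i) := by
    rw [mul_sum, ← sum_neg_distrib]
    refine sum_congr rfl fun i _ => by ring
  calc Real.exp (-(β * ∑ i, hA.eigenvalues i * w i))
      = Real.exp (∑ i, w i * -(β * hA.eigenvalues i)) := by rw [hlhs]
    _ ≤ ∑ i, w i * Real.exp (-(β * hA.eigenvalues i)) := hJ
    _ = ∑ i, Real.exp (-(β * hA.eigenvalues i)) * w i := sum_congr rfl fun i _ => mul_comm _ _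

/-- **A PSD matrix's trace dominates its quadratic form on unit vectors**:
`Re ⟨ψ, N ψ⟩ ≤ Re tr N` for `N ≥ 0`, `‖ψ‖ = 1`. [folklore] -/
theorem re_quadForm_le_trace_of_posSemidef {N : Matrix n n ℂ} (hN : N.PosSemidef) (ψ : n → ℂ)
    (hψ : star ψ ⬝ᵥ ψ = 1) : (star ψ ⬝ᵥ (N *ᵥ ψ)).re ≤ N.trace.re := by
  have hNh : N.IsHermitian := hN.isHermitian
  have hU : (hNh.eigenvectorUnitary : Matrix n n ℂ) ∈ unitary (Matrix n n ℂ) :=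
    hNh.eigenvectorUnitary.prop
  set w : n → ℝ := fun i => ‖(star (hNh.eigenvectorUnitary : Matrix n n ℂ) *ᵥ ψ) i‖ ^ 2 with hw
  have hw1 : ∑ i, w i = 1 := by
    rw [hw, sum_norm_sq_star_mulVec hU ψ, hψ]; simp
  have hwle : ∀ i, w i ≤ 1 := fun i => by
    rw [← hw1]; exact single_le_sum (fun j _ => by positivity) (mem_univ i)
  rw [re_quadForm_eq_sum_eigenvalues hNh ψ, hNh.trace_eq_sum_eigenvalues, Complex.re_sum]
  refine sum_le_sum fun i _ => ?_
  have h0 : 0 ≤ hNh.eigenvalues i := hN.eigenvalues_nonneg i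
  calc hNh.eigenvalues i * w i ≤ hNh.eigenvalues i * 1 :=
        mul_le_mul_of_nonneg_left (hwle i) h0
    _ = hNh.eigenvalues i := mul_one _
    _ = _ := by simp

/-- **Peierls–Jensen in a sector.** For an idempotent Hermitian `P` commuting with the Hermitian
`K` and a unit vector `ψ` with `P ψ = ψ`: `exp(-β Re⟨ψ, K ψ⟩) ≤ Re tr (P e^{-βK})`. [folklore] -/
theorem sectorZ_ge_exp_quadForm {P K : Matrix n n ℂ} (hP : P * P = P) (hPh : P.IsHermitian)
    (hPK : Commute P K) (hK : K.IsHermitian) (β : ℝ) (ψ : n → ℂ) (hPψ : P *ᵥ ψ = ψ)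
    (hψ : star ψ ⬝ᵥ ψ = 1) :
    Real.exp (-(β * (star ψ ⬝ᵥ (K *ᵥ ψ)).re)) ≤ (P * gibbsWeight β K).trace.re := by
  -- `e^{-βK}` commutes with `P`
  have hPW : Commute P (gibbsWeight β K) := by
    have : Commute P (-(β : ℂ) • K) := (hPK.smul_right _)
    exact this.exp_right
  -- `tr (P W) = tr (P W P)` and `P W P ≥ 0`
  have hW : (gibbsWeight β K).PosSemidef := (posDef_gibbsWeight β hK).posSemidef
  have hPWP : (P * gibbsWeight β K * P).PosSemidef := by
    have := hW.conjTranspose_mul_mul_same P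
    rwa [hPh.eq] at this
  have htr : (P * gibbsWeight β K).trace = (P * gibbsWeight β K * P).trace := by
    rw [Matrix.mul_assoc, ← hPW.eq, ← Matrix.mul_assoc, hP]
  -- the quadratic form of `P W P` at `ψ` is that of `W`
  have hv : star ψ ᵥ* P = star ψ := by
    conv_lhs => rw [← hPh.eq]
    rw [vecMul_conjTranspose, star_star, hPψ]
  have hquad : star ψ ⬝ᵥ ((P * gibbsWeight β K * P) *ᵥ ψ) =
      star ψ ⬝ᵥ (gibbsWeight β K *ᵥ ψ) := by
    rw [← mulVec_mulVec, ← mulVec_mulVec, hPψ, dotProduct_mulVec, hv]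
  rw [htr]
  calc Real.exp (-(β * (star ψ ⬝ᵥ (K *ᵥ ψ)).re))
      ≤ (star ψ ⬝ᵥ (gibbsWeight β K *ᵥ ψ)).re := exp_neg_mul_quadForm_le hK β ψ hψ
    _ = (star ψ ⬝ᵥ ((P * gibbsWeight β K * P) *ᵥ ψ)).re := by rw [hquad]
    _ ≤ (P * gibbsWeight β K * P).trace.re := re_quadForm_le_trace_of_posSemidef hPWP ψ hψ

/-- **Positivity of the sector partition function seen by a sector vector**: under the hypotheses of
`sectorZ_ge_exp_quadForm`, `0 < Re tr (P e^{-βK})`. [folklore] -/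
theorem sectorZ_pos_of_mem {P K : Matrix n n ℂ} (hP : P * P = P) (hPh : P.IsHermitian)
    (hPK : Commute P K) (hK : K.IsHermitian) (β : ℝ) (ψ : n → ℂ) (hPψ : P *ᵥ ψ = ψ)
    (hψ : star ψ ⬝ᵥ ψ = 1) : 0 < (P * gibbsWeight β K).trace.re :=
  lt_of_lt_of_le (Real.exp_pos _) (sectorZ_ge_exp_quadForm hP hPh hPK hK β ψ hPψ hψ)

/-- **Softmin ≤ eigenvector expectation** (Peierls' inequality for the vector state; the first
inequality of the lever of card softmin-pair-penalty): with `K = H - e·1 + B`, `H ψ = e ψ`, `P ψ = ψ`,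
`‖ψ‖ = 1`, `-(1/β) · log Re tr (P e^{-βK}) ≤ Re ⟨ψ, B ψ⟩`. Only uses that `ψ` is an eigenvector in
the sector, not that `e` is minimal. [folklore] -/
theorem softmin_le_expect {P H B : Matrix n n ℂ} (hP : P * P = P) (hPh : P.IsHermitian)
    (hPH : Commute P H) (hPB : Commute P B) (hH : H.IsHermitian) (hB : B.IsHermitian)
    {β : ℝ} (hβ : 0 < β) (e : ℝ) (ψ : n → ℂ) (hPψ : P *ᵥ ψ = ψ) (hψ : star ψ ⬝ᵥ ψ = 1)
    (hHψ : H *ᵥ ψ = ((e : ℝ) : ℂ) • ψ) :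
    -(1 / β) * Real.log (P * gibbsWeight β (H - ((e : ℝ) : ℂ) • (1 : Matrix n n ℂ) + B)).trace.re
      ≤ (star ψ ⬝ᵥ (B *ᵥ ψ)).re := by
  set K : Matrix n n ℂ := H - ((e : ℝ) : ℂ) • (1 : Matrix n n ℂ) + B with hKdef
  have hK : K.IsHermitian := by
    rw [hKdef]
    refine IsHermitian.add (IsHermitian.sub hH ?_) hB
    unfold Matrix.IsHermitian
    rw [conjTranspose_smul, conjTranspose_one, Complex.star_def, Complex.conj_ofReal]
  have hPK : Commute P K := by
    rw [hKdef]
    exact (hPH.sub_right ((Commute.one_right P).smul_right _)).add_right hPB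
  -- `⟨ψ, Kψ⟩ = ⟨ψ, Bψ⟩`
  have hKψ : (star ψ ⬝ᵥ (K *ᵥ ψ)).re = (star ψ ⬝ᵥ (B *ᵥ ψ)).re := by
    have : K *ᵥ ψ = B *ᵥ ψ := by
      rw [hKdef, add_mulVec, sub_mulVec, hHψ, smul_mulVec, one_mulVec, sub_self, zero_add]
    rw [this]
  have hZ := sectorZ_ge_exp_quadForm hP hPh hPK hK β ψ hPψ hψ
  rw [hKψ] at hZ
  have hZpos : 0 < (P * gibbsWeight β K).trace.re := lt_of_lt_of_le (Real.exp_pos _) hZ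
  have hlog : -(β * (star ψ ⬝ᵥ (B *ᵥ ψ)).re) ≤ Real.log (P * gibbsWeight β K).trace.re := by
    rw [← Real.log_exp (-(β * (star ψ ⬝ᵥ (B *ᵥ ψ)).re))]
    exact Real.log_le_log (Real.exp_pos _) hZ
  have hβ' : 0 < 1 / β := by positivity
  have := mul_le_mul_of_nonneg_left hlog hβ'.le
  have hcancel : 1 / β * -(β * (star ψ ⬝ᵥ (B *ᵥ ψ)).re) = -(star ψ ⬝ᵥ (B *ᵥ ψ)).re := by
    field_simp
  rw [hcancel] at this
  linarith

end Summit.HubbardSuperconductivity.HubbardSuperconductivity.Theorems.BirGroundStateAverageLRO.Softmin
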